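import Mathlib
import Literature.NumberTheory.DiophantineGeometry.AbcWave0
import Literature.NumberTheory.DiophantineGeometry.AbcWave0RothProofs

/-!
# Stratum R of line `fourth-radical-binomial-thue`: a fixed box of binomial quartic forms has every saving `η < 2`

Helper (`--supports`) for the crux `Summit.ABC.ABC.Theses.IneffectiveSubspace.TowerFourSubLiouville`
(stmt-ABC-1649), line `fourth-radical-binomial-thue`, stub `stub_fixedFormsRoth`.

**Statement (`stub_fixedFormsRoth`).** For every `H : ℕ` and every `0 < η < 2` there is `Z₀` such that
for all naturals `v, w, Y, Z` with `Z ≥ Z₀`, `max v w ≤ H`, `v, w, Y > 0`, `gcd(vY, wZ) = 1`,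
`max v w ≤ Z^η` and `wZ⁴ ≠ vY⁴` one has `Z^η < |wZ⁴ − vY⁴|` — a power saving `η` over Liouville's trivial
`|wZ⁴ − vY⁴| ≥ 1`, uniformly over the finite box of coefficient pairs (the threshold `Z₀(H, η)` is
ineffective). The hypotheses `0 < Y`, the coprimality and `max v w ≤ Z^η` are part of the registered
statement but are not used.

**Proof** (Thue–Siegel–Roth, form by form). Fix `v, w ≥ 1` and let `θ > 0` be the real fourth root of
`w / v`. It is algebraic (`θ⁴ ∈ ℚ`), so it is not `LiouvilleWith p` for any `p > 2`: for irrational `θ`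
this is Roth's theorem [cite: Roth1955] via the tree's `roth_holds` (Schmidt1980 Ch. V), and a rational
number is not `LiouvilleWith p` for any `p > 1` (Mathlib's `LiouvilleWith.irrational`). Unfolding, with
`p = 2 + ε`, `ε = (2 − η)/2`: for all large `Z` and all integers `m` with `θ ≠ m/Z`,
`|θ − m/Z| ≥ Z^(−p)`. Now `wZ⁴ − vY⁴ = vZ⁴(θ⁴ − r⁴)` with `r = Y/Z ≥ 0`, the value `θ = r` is excluded by
`wZ⁴ ≠ vY⁴`, and `|θ⁴ − r⁴| = |θ − r|(θ + r)(θ² + r²) ≥ θ³|θ − r|`, so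
`|wZ⁴ − vY⁴| ≥ vθ³ · Z⁴ · Z^(−2−ε) = vθ³ · Z^η · Z^ε > Z^η` as soon as `Z^ε > 1/(vθ³)`. This gives a
threshold `Z₀(v, w, η)`; for the box take the maximum over `v, w ≤ H` (`Finset.sup`).

Ingredients: `Literature.NumberTheory.DiophantineGeometry.roth_holds` (PROVED in the tree, standard
axioms) and Mathlib (`LiouvilleWith`, `IsAlgebraic.of_pow`, the `Real.rpow` API). No unproved facts.
-/

-- `Summit.ABC.ABC` is the mandated summit-side namespace (CONVENTIONS §2); the duplicate is deliberate.
set_option linter.dupNamespace false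

namespace Summit.ABC.ABC.Theorems.TowerFourSubLiouville

open Filter

/-- A positive real fourth root: for naturals `v, w > 0` there is `θ > 0` with `θ⁴ = w / v`. [folklore] -/
theorem fixedFormsRoth_exists_fourth_root {v w : ℕ} (hv : 0 < v) (hw : 0 < w) :
    ∃ θ : ℝ, 0 < θ ∧ θ ^ 4 = (w : ℝ) / v := by
  refine ⟨((w : ℝ) / v) ^ ((4 : ℕ) : ℝ)⁻¹, ?_, ?_⟩
  · exact Real.rpow_pos_of_pos (by positivity) _
  · exact Real.rpow_inv_natCast_pow (by positivity) (by norm_num)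

/-- A real number whose fourth power is the rational `w / v` is algebraic over `ℚ`. [folklore] -/
theorem fixedFormsRoth_isAlgebraic {v w : ℕ} {θ : ℝ} (hθ : θ ^ 4 = (w : ℝ) / v) :
    IsAlgebraic ℚ θ := by
  have h4 : IsAlgebraic ℚ (θ ^ 4) := by
    have h := isAlgebraic_algebraMap (R := ℚ) (A := ℝ) ((w : ℚ) / v)
    rw [eq_ratCast] at h
    push_cast at h
    rwa [hθ]
  exact IsAlgebraic.of_pow (by norm_num) h4

/-- **Roth + the rational case.** A real algebraic number `θ` is not `LiouvilleWith p` for any `p > 2`: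
for irrational `θ` this is Roth's theorem (`roth_holds`, [cite: Roth1955]; Schmidt, LNM 785, Ch. V), and a
`LiouvilleWith p` number with `p > 1` is irrational (Mathlib). -/
theorem fixedFormsRoth_not_liouvilleWith {θ : ℝ} (halg : IsAlgebraic ℚ θ) {p : ℝ} (hp : 2 < p) :
    ¬ LiouvilleWith p θ := by
  have hR : ∀ {x : ℝ}, IsAlgebraic ℚ x → Irrational x → ∀ {p : ℝ}, 2 < p → ¬ LiouvilleWith p x :=
    Literature.NumberTheory.DiophantineGeometry.roth_holds
  by_cases hirr : Irrational θ
  · exact hR halg hirr hp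
  · exact fun h => hirr (h.irrational (by linarith))

/-- The non-Liouville property unfolded (constant `C = 1`): beyond some denominator `N`, every rational
`m / n ≠ θ` satisfies `|θ − m/n| ≥ n^(−p)`. [folklore] -/
theorem fixedFormsRoth_approx {θ : ℝ} (halg : IsAlgebraic ℚ θ) {p : ℝ} (hp : 2 < p) :
    ∃ N : ℕ, ∀ n : ℕ, N ≤ n → ∀ m : ℤ, θ ≠ m / n → 1 / (n : ℝ) ^ p ≤ |θ - m / n| := by
  have h := fixedFormsRoth_not_liouvilleWith halg hp
  simp only [LiouvilleWith, not_exists, Filter.not_frequently, not_and, not_lt,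
    Filter.eventually_atTop] at h
  exact h 1

/-- **One form.** For fixed `v, w ≥ 1` and `0 < η < 2` there is `Z₀` with `Z^η < |wZ⁴ − vY⁴|` for all
`Z ≥ Z₀` and all `Y` with `wZ⁴ ≠ vY⁴` (Thue–Siegel–Roth for `θ = (w/v)^(1/4)`). [cite: Roth1955] -/
theorem fixedFormsRoth_pair {η : ℝ} (hη2 : η < 2) {v w : ℕ} (hv : 0 < v) (hw : 0 < w) :
    ∃ Z₀ : ℕ, ∀ Y Z : ℕ, Z₀ ≤ Z → w * Z ^ 4 ≠ v * Y ^ 4 →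
      (Z : ℝ) ^ η < |((w * Z ^ 4 : ℕ) : ℝ) - ((v * Y ^ 4 : ℕ) : ℝ)| := by
  obtain ⟨θ, hθpos, hθ4⟩ := fixedFormsRoth_exists_fourth_root hv hw
  set ε : ℝ := (2 - η) / 2 with hε_def
  have hε : 0 < ε := by rw [hε_def]; linarith
  have hp : (2 : ℝ) < 2 + ε := by linarith
  obtain ⟨N₁, hN₁⟩ := fixedFormsRoth_approx (fixedFormsRoth_isAlgebraic hθ4) hp
  -- the constant `c = v θ³` and a threshold beyond which `c · Z^ε > 1`
  set c : ℝ := (v : ℝ) * θ ^ 3 with hc_def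
  have hc : 0 < c := by positivity
  have ht : Tendsto (fun n : ℕ => ((n : ℝ)) ^ ε) atTop atTop :=
    (tendsto_rpow_atTop hε).comp tendsto_natCast_atTop_atTop
  obtain ⟨N₂, hN₂⟩ := Filter.eventually_atTop.1 (ht.eventually_gt_atTop (1 / c))
  refine ⟨max N₁ (max N₂ 1), fun Y Z hZ hne => ?_⟩
  have hZ₁ : N₁ ≤ Z := le_trans (le_max_left _ _) hZ
  have hZ₂ : N₂ ≤ Z := le_trans (le_trans (le_max_left _ _) (le_max_right _ _)) hZ
  have hZ1 : 1 ≤ Z := le_trans (le_trans (le_max_right _ _) (le_max_right _ _)) hZ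
  have hZr : (0 : ℝ) < Z := by exact_mod_cast hZ1
  have hv0 : (v : ℝ) ≠ 0 := by positivity
  have hcZ : 1 / c < (Z : ℝ) ^ ε := hN₂ Z hZ₂
  -- `θ ≠ Y / Z`, since `θ⁴ = w / v` and `wZ⁴ ≠ vY⁴`
  have hne' : θ ≠ ((Y : ℤ) : ℝ) / (Z : ℝ) := by
    intro h
    apply hne
    have h' : θ ^ 4 = (Y : ℝ) ^ 4 / (Z : ℝ) ^ 4 := by rw [h]; push_cast; ring
    rw [hθ4, div_eq_div_iff hv0 (pow_ne_zero 4 hZr.ne')] at h'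
    have key : (w : ℝ) * (Z : ℝ) ^ 4 = (v : ℝ) * (Y : ℝ) ^ 4 := by linarith
    exact_mod_cast key
  -- Roth's inequality at `m / n = Y / Z`
  have happrox : 1 / (Z : ℝ) ^ (2 + ε) ≤ |θ - ((Y : ℤ) : ℝ) / (Z : ℝ)| := hN₁ Z hZ₁ (Y : ℤ) hne'
  rw [Int.cast_natCast] at happrox
  set r : ℝ := (Y : ℝ) / (Z : ℝ) with hr_def
  have hr : 0 ≤ r := by positivity
  -- the identity `wZ⁴ − vY⁴ = vZ⁴ (θ + r)(θ² + r²) · (θ − r)`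
  have hw' : (w : ℝ) = v * θ ^ 4 := by rw [hθ4]; field_simp
  have hD : ((w * Z ^ 4 : ℕ) : ℝ) - ((v * Y ^ 4 : ℕ) : ℝ) =
      (v : ℝ) * (Z : ℝ) ^ 4 * ((θ + r) * (θ ^ 2 + r ^ 2)) * (θ - r) := by
    push_cast
    rw [hw', hr_def]
    field_simp
    ring
  have hP : θ ^ 3 ≤ (θ + r) * (θ ^ 2 + r ^ 2) := by
    have h0 : 0 ≤ θ * r ^ 2 + r * θ ^ 2 + r ^ 3 := by positivity
    nlinarith [h0]
  have hA : 0 < (v : ℝ) * (Z : ℝ) ^ 4 * ((θ + r) * (θ ^ 2 + r ^ 2)) := by positivity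
  have habsD : |((w * Z ^ 4 : ℕ) : ℝ) - ((v * Y ^ 4 : ℕ) : ℝ)| =
      (v : ℝ) * (Z : ℝ) ^ 4 * ((θ + r) * (θ ^ 2 + r ^ 2)) * |θ - r| := by
    rw [hD, abs_mul, abs_of_pos hA]
  -- the lower bound `c · Z⁴ · Z^(−2−ε) ≤ |wZ⁴ − vY⁴|`
  have hlow : c * (Z : ℝ) ^ 4 * (1 / (Z : ℝ) ^ (2 + ε)) ≤
      |((w * Z ^ 4 : ℕ) : ℝ) - ((v * Y ^ 4 : ℕ) : ℝ)| := by
    rw [habsD]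
    have h1 : c * (Z : ℝ) ^ 4 ≤ (v : ℝ) * (Z : ℝ) ^ 4 * ((θ + r) * (θ ^ 2 + r ^ 2)) := by
      have hvZ : 0 ≤ (v : ℝ) * (Z : ℝ) ^ 4 := by positivity
      calc c * (Z : ℝ) ^ 4 = (v : ℝ) * (Z : ℝ) ^ 4 * θ ^ 3 := by rw [hc_def]; ring
        _ ≤ (v : ℝ) * (Z : ℝ) ^ 4 * ((θ + r) * (θ ^ 2 + r ^ 2)) :=
            mul_le_mul_of_nonneg_left hP hvZ
    exact mul_le_mul h1 happrox (by positivity) hA.le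
  -- exponent bookkeeping: `Z⁴ · Z^(−(2+ε)) = Z^η · Z^ε`
  have hexp : (4 : ℝ) - (2 + ε) = η + ε := by rw [hε_def]; ring
  have hpow : (Z : ℝ) ^ 4 * (1 / (Z : ℝ) ^ (2 + ε)) = (Z : ℝ) ^ η * (Z : ℝ) ^ ε := by
    rw [← Real.rpow_add hZr, ← hexp, Real.rpow_sub hZr, mul_one_div]
    congr 1
    exact_mod_cast (Real.rpow_natCast (Z : ℝ) 4).symm
  have hZη : 0 < (Z : ℝ) ^ η := Real.rpow_pos_of_pos hZr η
  have hcZ' : 1 < c * (Z : ℝ) ^ ε := by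
    have h := mul_lt_mul_of_pos_left hcZ hc
    rwa [mul_one_div_cancel hc.ne'] at h
  calc (Z : ℝ) ^ η = (Z : ℝ) ^ η * 1 := (mul_one _).symm
    _ < (Z : ℝ) ^ η * (c * (Z : ℝ) ^ ε) := mul_lt_mul_of_pos_left hcZ' hZη
    _ = c * ((Z : ℝ) ^ 4 * (1 / (Z : ℝ) ^ (2 + ε))) := by rw [hpow]; ring
    _ = c * (Z : ℝ) ^ 4 * (1 / (Z : ℝ) ^ (2 + ε)) := by ring
    _ ≤ _ := hlow

/-- **`stub_fixedFormsRoth`** (stratum R of line `fourth-radical-binomial-thue`, crux stmt-ABC-1649; the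
registered statement, fully unfolded). For every finite box `max v w ≤ H` of coefficient pairs and every
saving `0 < η < 2` there is an (ineffective) `Z₀ = Z₀(H, η)` beyond which every admissible quadruple with
`wZ⁴ ≠ vY⁴` has `Z^η < |wZ⁴ − vY⁴|`. Proof: `fixedFormsRoth_pair` (Thue–Siegel–Roth per form) and the
maximum of the finitely many thresholds over the box. [cite: Roth1955] -/
theorem stub_fixedFormsRoth : ∀ H : ℕ, ∀ η : ℝ, 0 < η → η < 2 → ∃ Z₀ : ℕ, ∀ v w Y Z : ℕ, Z₀ ≤ Z → max v w ≤ H → 0 < v → 0 < w → 0 < Y → Nat.Coprime (v * Y) (w * Z) → ((max v w : ℕ) : ℝ) ≤ (Z : ℝ) ^ η → w * Z ^ 4 ≠ v * Y ^ 4 → (Z : ℝ) ^ η < |((w * Z ^ 4 : ℕ) : ℝ) - ((v * Y ^ 4 : ℕ) : ℝ)| := by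
  intro H η _hη hη2
  -- a threshold for every pair `(v, w)` (vacuous for `v = 0` or `w = 0`)
  have hpair : ∀ v w : ℕ, ∃ Z₀ : ℕ, ∀ Y Z : ℕ, Z₀ ≤ Z → 0 < v → 0 < w → w * Z ^ 4 ≠ v * Y ^ 4 →
      (Z : ℝ) ^ η < |((w * Z ^ 4 : ℕ) : ℝ) - ((v * Y ^ 4 : ℕ) : ℝ)| := by
    intro v w
    rcases Nat.eq_zero_or_pos v with hv | hv
    · exact ⟨0, fun Y Z _ hv' _ _ => absurd hv' (by omega)⟩
    rcases Nat.eq_zero_or_pos w with hw | hw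
    · exact ⟨0, fun Y Z _ _ hw' _ => absurd hw' (by omega)⟩
    obtain ⟨Z₀, hZ₀⟩ := fixedFormsRoth_pair hη2 hv hw
    exact ⟨Z₀, fun Y Z hZ _ _ hne => hZ₀ Y Z hZ hne⟩
  choose f hf using hpair
  refine ⟨(Finset.range (H + 1) ×ˢ Finset.range (H + 1)).sup (fun q => f q.1 q.2), ?_⟩
  intro v w Y Z hZ hmax hv hw _hY _hcop _hle hne
  have hmem : (v, w) ∈ Finset.range (H + 1) ×ˢ Finset.range (H + 1) := by
    rw [Finset.mem_product, Finset.mem_range, Finset.mem_range]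
    exact ⟨Nat.lt_succ_of_le (le_of_max_le_left hmax), Nat.lt_succ_of_le (le_of_max_le_right hmax)⟩
  have hfle : f v w ≤ Z :=
    le_trans (Finset.le_sup (f := fun q : ℕ × ℕ => f q.1 q.2) hmem) hZ
  exact hf v w Y Z hfle hv hw hne

end Summit.ABC.ABC.Theorems.TowerFourSubLiouville
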